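import Summits.Parity.GeneralizedHardyLittlewood.Theorems.GreenTaoLevelTwoGITwoCyclicInverseGenFourierDecay
import Mathlib.Analysis.SpecialFunctions.Complex.CircleAddChar
import Mathlib.Data.Complex.BigOperators

/-!
# Route `GreenTaoLevelTwo`, crux `GITwo` (stmt-Parity-21275), line `birth`, stub `stub_cyclicInverse`:
# the local Bessel inequality on a regular Bohr set (GT08a arXiv Cor. 40)

Twenty-ninth helper file toward the XL stub `stub_cyclicInverse` (B. Green, T. Tao, *An inverse
theorem for the Gowers `U³(G)` norm*, arXiv:math/0503014, Thm. 68 = PEMS 51 (2008) Thm. 12.8).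
Block B7, arXiv Corollary 40 (Tomas–Stein / large-sieve almost orthogonality): if the frequencies
of a finite set `F` are pairwise `δ`-separated in `‖·‖_{B(S,τρ)}` then
`𝔼_{x∈B} |Σ_{ζ∈F} b_ζ e(ζx)|² ≤ k + 2⁷ k² (τd/δ)^{1/2}` (`k = #F`, `|b_ζ| ≤ 1`, `B = B(S,ρ)`
regular).  We separate the two ingredients:

* `stdAddChar_eq_toCircle` — Mathlib's standard character `ZMod.stdAddChar` is
  `AddCircle.toCircle ∘ toAddCircle`, the character of the sibling files (definitionally);
* `sum_norm_sq_sum_le_of_almost_orthogonal` — the ALMOST-ORTHOGONALITY lemma: for any finsets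
  `B, F ⊆ ℤ/Nℤ`, coefficients `|b_ζ| ≤ 1` and `γ ≥ 0` with `|Σ_{x∈B} e(x(ζ−ζ'))| ≤ γ #B` for
  `ζ ≠ ζ'` in `F`: `Σ_{x∈B} |Σ_{ζ∈F} b_ζ e(xζ)|² ≤ (#F + #F² γ) #B`;
* `norm_sum_stdAddChar_le_of_separated` — **the decay input (arXiv Cor. 39, square-root form, re-derived
  from arXiv Lemma 38 `norm_phase_le_of_locAdd`)**: for `B = B(S,ρ)`
  regular, `τ > 0` and `ζ` with a witness `y ∈ B(S,τρ)`, `‖yζ‖_{ℝ/ℤ} ≥ δ > 0`: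
  `|Σ_{x∈B} e(xζ)| ≤ 64 (τ d/δ)^{1/2} #B`;
* `sum_norm_sq_sum_le_of_separated` — **arXiv Cor. 40**: for `F` pairwise `δ`-separated in
  `‖·‖_{B(S,τρ)}` (each difference has such a witness), `Σ_{x∈B} |Σ_{ζ∈F} b_ζ e(xζ)|² ≤
  (#F + #F² · 64 (τd/δ)^{1/2}) #B` (the paper bounds the off-diagonal count by `2·C(k,2)`, we by
  `k²`, whence `64` in place of `2⁷/2`).

References: [GreenTao2008U3Inverse] arXiv:math/0503014, Cor. 39, Cor. 40.
-/

noncomputable section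

namespace Summit.Parity.GeneralizedHardyLittlewood.GreenTaoLevelTwoGITwoCyclicInverse

open Finset

open scoped ComplexConjugate

variable {N : ℕ} [NeZero N]

/-- The standard character is the character `AddCircle.toCircle ∘ toAddCircle` of the sibling
files. [folklore] -/
theorem stdAddChar_eq_toCircle (a : ZMod N) :
    (ZMod.stdAddChar a : ℂ) = ((AddCircle.toCircle (ZMod.toAddCircle a) : Circle) : ℂ) := rfl

/-- **Almost orthogonality (Tomas–Stein; the engine of GT08a arXiv Cor. 40).**  For finsets
`B, F ⊆ ℤ/Nℤ`, coefficients `‖b_ζ‖ ≤ 1` on `F` and `γ ≥ 0` such that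
`‖Σ_{x∈B} e(x(ζ−ζ'))‖ ≤ γ #B` whenever `ζ ≠ ζ'` lie in `F`:
`Σ_{x∈B} ‖Σ_{ζ∈F} b_ζ e(xζ)‖² ≤ (#F + #F² γ) #B`. [cite: GreenTao2008U3Inverse, Cor. 40 (proof)] -/
theorem sum_norm_sq_sum_le_of_almost_orthogonal (B F : Finset (ZMod N)) (b : ZMod N → ℂ)
    (hb : ∀ ζ ∈ F, ‖b ζ‖ ≤ 1) {γ : ℝ} (hγ0 : 0 ≤ γ)
    (hγ : ∀ ζ ∈ F, ∀ ζ' ∈ F, ζ ≠ ζ' →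
      ‖∑ x ∈ B, (ZMod.stdAddChar (x * (ζ - ζ')) : ℂ)‖ ≤ γ * #B) :
    ∑ x ∈ B, ‖∑ ζ ∈ F, b ζ * ZMod.stdAddChar (x * ζ)‖ ^ 2 ≤ ((#F : ℝ) + (#F : ℝ) ^ 2 * γ) * #B := by
  classical
  set ψ : ZMod N → ℂ := fun a => (ZMod.stdAddChar a : ℂ) with hψ
  -- pointwise expansion of `|P(x)|²`
  have hexp : ∀ x : ZMod N, ((‖∑ ζ ∈ F, b ζ * ψ (x * ζ)‖ ^ 2 : ℝ) : ℂ) =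
      ∑ ζ ∈ F, ∑ ζ' ∈ F, b ζ * conj (b ζ') * ψ (x * (ζ - ζ')) := by
    intro x
    rw [← Complex.normSq_eq_norm_sq, ← Complex.mul_conj, map_sum, sum_mul_sum]
    refine sum_congr rfl fun ζ _ => sum_congr rfl fun ζ' _ => ?_
    rw [map_mul, hψ]
    simp only
    -- `conj e(a) = e(−a)` (the tree's `Literature…PointedModular.stdAddChar_conj`, inlined)
    have hconj : conj (ZMod.stdAddChar (x * ζ') : ℂ) = ZMod.stdAddChar (-(x * ζ')) := by
      rw [ZMod.stdAddChar_apply, ZMod.stdAddChar_apply, AddChar.map_neg_eq_inv,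
        Circle.coe_inv_eq_conj]
    rw [hconj, mul_mul_mul_comm, ← AddChar.map_add_eq_mul]
    congr 2; ring
  -- sum over `x` and exchange
  have htot : ((∑ x ∈ B, ‖∑ ζ ∈ F, b ζ * ψ (x * ζ)‖ ^ 2 : ℝ) : ℂ) =
      ∑ ζ ∈ F, ∑ ζ' ∈ F, b ζ * conj (b ζ') * ∑ x ∈ B, ψ (x * (ζ - ζ')) := by
    rw [Complex.ofReal_sum, sum_congr rfl fun x _ => hexp x, sum_comm]
    refine sum_congr rfl fun ζ _ => ?_
    rw [sum_comm]
    refine sum_congr rfl fun ζ' _ => ?_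
    rw [mul_sum]
  -- take norms
  have hnorm : (∑ x ∈ B, ‖∑ ζ ∈ F, b ζ * ψ (x * ζ)‖ ^ 2 : ℝ) ≤
      ∑ ζ ∈ F, ∑ ζ' ∈ F, ‖∑ x ∈ B, ψ (x * (ζ - ζ'))‖ := by
    have h1 : (∑ x ∈ B, ‖∑ ζ ∈ F, b ζ * ψ (x * ζ)‖ ^ 2 : ℝ) =
        ‖((∑ x ∈ B, ‖∑ ζ ∈ F, b ζ * ψ (x * ζ)‖ ^ 2 : ℝ) : ℂ)‖ := by
      rw [Complex.norm_real, Real.norm_eq_abs, abs_of_nonneg (by positivity)]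
    rw [h1, htot]
    refine (norm_sum_le _ _).trans (sum_le_sum fun ζ hζ => ?_)
    refine (norm_sum_le _ _).trans (sum_le_sum fun ζ' hζ' => ?_)
    rw [norm_mul, norm_mul, Complex.norm_conj]
    calc ‖b ζ‖ * ‖b ζ'‖ * ‖∑ x ∈ B, ψ (x * (ζ - ζ'))‖
        ≤ 1 * 1 * ‖∑ x ∈ B, ψ (x * (ζ - ζ'))‖ :=
          mul_le_mul_of_nonneg_right
            (mul_le_mul (hb ζ hζ) (hb ζ' hζ') (norm_nonneg _) zero_le_one) (norm_nonneg _)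
      _ = ‖∑ x ∈ B, ψ (x * (ζ - ζ'))‖ := by ring
  -- diagonal and off-diagonal terms
  have hterm : ∀ ζ ∈ F, ∀ ζ' ∈ F, ‖∑ x ∈ B, ψ (x * (ζ - ζ'))‖ ≤
      (if ζ = ζ' then (#B : ℝ) else γ * #B) := by
    intro ζ hζ ζ' hζ'
    split_ifs with h
    · calc ‖∑ x ∈ B, ψ (x * (ζ - ζ'))‖ ≤ ∑ x ∈ B, ‖ψ (x * (ζ - ζ'))‖ := norm_sum_le _ _
        _ = ∑ x ∈ B, (1 : ℝ) := sum_congr rfl fun x _ => by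
            rw [hψ]; simp only; rw [ZMod.stdAddChar_apply]; exact Circle.norm_coe _
        _ = #B := by simp
    · exact hγ ζ hζ ζ' hζ' h
  calc (∑ x ∈ B, ‖∑ ζ ∈ F, b ζ * ψ (x * ζ)‖ ^ 2 : ℝ)
      ≤ ∑ ζ ∈ F, ∑ ζ' ∈ F, ‖∑ x ∈ B, ψ (x * (ζ - ζ'))‖ := hnorm
    _ ≤ ∑ ζ ∈ F, ∑ ζ' ∈ F, (if ζ = ζ' then (#B : ℝ) else γ * #B) :=
        sum_le_sum fun ζ hζ => sum_le_sum fun ζ' hζ' => hterm ζ hζ ζ' hζ'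
    _ ≤ ∑ ζ ∈ F, ∑ ζ' ∈ F, ((if ζ = ζ' then (#B : ℝ) else 0) + γ * #B) := by
        refine sum_le_sum fun ζ _ => sum_le_sum fun ζ' _ => ?_
        split_ifs
        · have : 0 ≤ γ * (#B : ℝ) := by positivity
          linarith
        · linarith
    _ = ((#F : ℝ) + (#F : ℝ) ^ 2 * γ) * #B := by
        simp only [sum_add_distrib, sum_ite_eq, sum_const, nsmul_eq_mul]
        have : ∑ ζ ∈ F, (if ζ ∈ F then (#B : ℝ) else 0) = ∑ ζ ∈ F, (#B : ℝ) :=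
          sum_congr rfl fun ζ hζ => if_pos hζ
        rw [this, sum_const, nsmul_eq_mul]
        ring

/-- **The decay input (GT08a arXiv Cor. 39, square-root form).**  For `S` nonempty (`d = #S`),
`ρ > 0`, `B = B(S,ρ)` regular, `τ > 0`, and a frequency `ζ` admitting a witness `y ∈ B(S,τρ)`
with `‖yζ‖_{ℝ/ℤ} ≥ δ > 0`: `‖Σ_{x∈B} e(xζ)‖ ≤ 64 (τ d/δ)^{1/2} #B`.
[cite: GreenTao2008U3Inverse, Cor. 39] -/
theorem norm_sum_stdAddChar_le_of_separated (S : Finset (ZMod N)) (hS : S.Nonempty) {ρ τ δ : ℝ}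
    (hρ : 0 < ρ) (hτ : 0 < τ) (hδ : 0 < δ)
    (hreg : ∀ κ : ℝ, |κ| ≤ 1 / (100 * (#S : ℝ)) →
      (1 - 100 * (#S : ℝ) * |κ|) * #{x : ZMod N | ∀ ξ ∈ S, ‖ZMod.toAddCircle (x * ξ)‖ < ρ} ≤
          #{x : ZMod N | ∀ ξ ∈ S, ‖ZMod.toAddCircle (x * ξ)‖ < (1 + κ) * ρ} ∧
        (#{x : ZMod N | ∀ ξ ∈ S, ‖ZMod.toAddCircle (x * ξ)‖ < (1 + κ) * ρ} : ℝ) ≤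
          (1 + 100 * (#S : ℝ) * |κ|) * #{x : ZMod N | ∀ ξ ∈ S, ‖ZMod.toAddCircle (x * ξ)‖ < ρ})
    {ζ y : ZMod N} (hy : ∀ ξ' ∈ S, ‖ZMod.toAddCircle (y * ξ')‖ < τ * ρ)
    (hyζ : δ ≤ ‖ZMod.toAddCircle (y * ζ)‖) :
    ‖∑ x ∈ ({x : ZMod N | ∀ ξ ∈ S, ‖ZMod.toAddCircle (x * ξ)‖ < ρ} : Finset (ZMod N)),
        (ZMod.stdAddChar (x * ζ) : ℂ)‖ ≤
      64 * Real.sqrt (τ * #S / δ) * #{x : ZMod N | ∀ ξ ∈ S, ‖ZMod.toAddCircle (x * ξ)‖ < ρ} := by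
  classical
  set B : Finset (ZMod N) := {x : ZMod N | ∀ ξ ∈ S, ‖ZMod.toAddCircle (x * ξ)‖ < ρ} with hBdef
  set T : ℝ := ‖∑ x ∈ B, (ZMod.stdAddChar (x * ζ) : ℂ)‖ with hT
  set c : ℝ := (#B : ℝ) with hc
  have hc0 : 0 < c := by
    have h1 : 1 ≤ #B := one_le_card_bohr S hρ
    rw [hc]; exact_mod_cast h1
  have hT0 : 0 ≤ T := norm_nonneg _
  rcases eq_or_lt_of_le hT0 with hT00 | hTpos
  · rw [← hT00]; positivity
  -- `η = T / c ∈ (0, 1]`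
  set η : ℝ := T / c with hη
  have hη0 : 0 < η := by positivity
  have hTle : T ≤ c := by
    rw [hT, hc]
    calc ‖∑ x ∈ B, (ZMod.stdAddChar (x * ζ) : ℂ)‖ ≤ ∑ x ∈ B, ‖(ZMod.stdAddChar (x * ζ) : ℂ)‖ :=
          norm_sum_le _ _
      _ = ∑ x ∈ B, (1 : ℝ) := sum_congr rfl fun x _ => by
          rw [ZMod.stdAddChar_apply]; exact Circle.norm_coe _
      _ = #B := by simp
  have hη1 : η ≤ 1 := by rw [hη, div_le_one hc0]; exact hTle
  have hbias : η * #B ≤ ‖∑ x ∈ B,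
      ((AddCircle.toCircle ((fun z : ZMod N => ZMod.toAddCircle (z * ζ)) x) : Circle) : ℂ)‖ := by
    have : η * #B = T := by rw [hη, hc, div_mul_cancel₀ _ hc0.ne']
    rw [this, hT]
    exact le_of_eq (congrArg _ (sum_congr rfl fun x _ => stdAddChar_eq_toCircle _))
  have hloc : ∀ x ∈ B, ∀ y ∈ B, (fun z : ZMod N => ZMod.toAddCircle (z * ζ)) (x + y) =
      (fun z : ZMod N => ZMod.toAddCircle (z * ζ)) x +
        (fun z : ZMod N => ZMod.toAddCircle (z * ζ)) y :=
    fun x _ y _ => by simp only [add_mul, map_add]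
  have hyB : ∀ ξ' ∈ S, ‖ZMod.toAddCircle (y * ξ')‖ ≤ τ * ρ := fun ξ' hξ' => (hy ξ' hξ').le
  have h38 := norm_phase_le_of_locAdd S hS hρ hη0 hη1 hreg
    (φ := fun z => ZMod.toAddCircle (z * ζ)) hloc hbias (y := y) (by positivity : 0 < τ * ρ) hyB
  -- `δ η² ≤ 2¹² d τ`
  have h1 : δ * η ^ 2 ≤ 2 ^ 12 * (#S : ℝ) * τ := by
    have h2 := hyζ.trans h38
    rw [le_div_iff₀ (by positivity)] at h2
    nlinarith
  -- `T² ≤ (64 √(τ d/δ) c)²`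
  have h3 : T ^ 2 ≤ (64 * Real.sqrt (τ * #S / δ) * c) ^ 2 := by
    rw [mul_pow, mul_pow, Real.sq_sqrt (by positivity)]
    have hTη : T = η * c := by rw [hη, div_mul_cancel₀ _ hc0.ne']
    rw [hTη, mul_pow]
    have h4 : η ^ 2 ≤ 2 ^ 12 * (#S : ℝ) * τ / δ := by
      rw [le_div_iff₀ hδ]; linarith
    calc η ^ 2 * c ^ 2 ≤ 2 ^ 12 * (#S : ℝ) * τ / δ * c ^ 2 :=
          mul_le_mul_of_nonneg_right h4 (sq_nonneg c)
      _ = 64 ^ 2 * (τ * #S / δ) * c ^ 2 := by ring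
  exact (pow_le_pow_iff_left₀ hT0 (by positivity) two_ne_zero).mp h3

/-- **Local Bessel inequality (GT08a arXiv Cor. 40).**  For `S` nonempty (`d = #S`), `ρ > 0`,
`B = B(S,ρ)` regular, `τ, δ > 0`, a finset `F` of frequencies pairwise `δ`-separated in
`‖·‖_{B(S,τρ)}` (every difference `ζ − ζ'` has a witness `y ∈ B(S,τρ)` with `‖y(ζ−ζ')‖ ≥ δ`)
and coefficients `‖b_ζ‖ ≤ 1`:
`Σ_{x∈B} ‖Σ_{ζ∈F} b_ζ e(xζ)‖² ≤ (#F + #F² · 64 (τd/δ)^{1/2}) #B`.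
[cite: GreenTao2008U3Inverse, Cor. 40] -/
theorem sum_norm_sq_sum_le_of_separated (S : Finset (ZMod N)) (hS : S.Nonempty) {ρ τ δ : ℝ}
    (hρ : 0 < ρ) (hτ : 0 < τ) (hδ : 0 < δ)
    (hreg : ∀ κ : ℝ, |κ| ≤ 1 / (100 * (#S : ℝ)) →
      (1 - 100 * (#S : ℝ) * |κ|) * #{x : ZMod N | ∀ ξ ∈ S, ‖ZMod.toAddCircle (x * ξ)‖ < ρ} ≤
          #{x : ZMod N | ∀ ξ ∈ S, ‖ZMod.toAddCircle (x * ξ)‖ < (1 + κ) * ρ} ∧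
        (#{x : ZMod N | ∀ ξ ∈ S, ‖ZMod.toAddCircle (x * ξ)‖ < (1 + κ) * ρ} : ℝ) ≤
          (1 + 100 * (#S : ℝ) * |κ|) * #{x : ZMod N | ∀ ξ ∈ S, ‖ZMod.toAddCircle (x * ξ)‖ < ρ})
    (F : Finset (ZMod N)) (b : ZMod N → ℂ) (hb : ∀ ζ ∈ F, ‖b ζ‖ ≤ 1)
    (hsep : ∀ ζ ∈ F, ∀ ζ' ∈ F, ζ ≠ ζ' → ∃ y : ZMod N,
      (∀ ξ' ∈ S, ‖ZMod.toAddCircle (y * ξ')‖ < τ * ρ) ∧ δ ≤ ‖ZMod.toAddCircle (y * (ζ - ζ'))‖) :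
    ∑ x ∈ ({x : ZMod N | ∀ ξ ∈ S, ‖ZMod.toAddCircle (x * ξ)‖ < ρ} : Finset (ZMod N)),
        ‖∑ ζ ∈ F, b ζ * ZMod.stdAddChar (x * ζ)‖ ^ 2 ≤
      ((#F : ℝ) + (#F : ℝ) ^ 2 * (64 * Real.sqrt (τ * #S / δ))) *
        #{x : ZMod N | ∀ ξ ∈ S, ‖ZMod.toAddCircle (x * ξ)‖ < ρ} := by
  refine sum_norm_sq_sum_le_of_almost_orthogonal _ F b hb (by positivity) fun ζ hζ ζ' hζ' hne => ?_
  obtain ⟨y, hy, hyζ⟩ := hsep ζ hζ ζ' hζ' hne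
  exact norm_sum_stdAddChar_le_of_separated S hS hρ hτ hδ hreg hy hyζ

end Summit.Parity.GeneralizedHardyLittlewood.GreenTaoLevelTwoGITwoCyclicInverse
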